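import Literature.MathematicalPhysics.QuantumFieldTheory.Balaban1983to89.B9Thm39Thm311AtLettersR
import Literature.MathematicalPhysics.QuantumFieldTheory.Balaban1983to89.B9Eq335CoveragePAtLettersY

/-!
# `Balaban1983to89.B9Thm311PrincipalAtLettersR` — row 17 of the N06 knit ([B9] Theorem 3.11) at def-Y's v4 letters from the pin and the PRINCIPAL
# COERCIVITY of the gauge-fixed form (3.26) ALONE: class-parametric (`bg9YR R₁ R₂`, plaquette smallness displayed on `R₁`) and at PRINT's class
# (`bg9YP`, plaquette smallness PROVED from (3.35) — only the coercivity and an explicit «α₀ small» inequality displayed)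

T. Bałaban, *Propagators for lattice gauge theories in a background field*, Commun. Math. Phys. **99** (1985) 389–434
[`Balaban1985BackgroundPropagators`, "B9"]; [4] = T. Bałaban, *Propagators and renormalization transformations for lattice gauge theories. II*,
Commun. Math. Phys. **96** (1984) 223–250 [`Balaban1984PropagatorsII`].

statement-level skeleton of published theorems with citation tags; proofs where landed; nothing here is a claim about the
Yang–Mills mass gap

THE PRINTED LOCI (verbatim).  p. 416, Theorem 3.11: *"Under the assumptions of the Theorems 3.1–3.10 (i.e. for M sufficiently large and α₀ sufficiently
small) the operators Δ′_a, G′, (Q′G′²Q′\*)⁻¹, Δ_a, G are positive definite."*;  p. 395, (3.26): *"⟨A, Δ_a A⟩ = ⟨A, Δ(U)A⟩ + ⟨D\*_U A, R(U) D\*_U A⟩ +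
⟨Q(U)A, Q(U)A⟩_a"* (the gauge-fixed quadratic form);  p. 404: *"the estimates follow directly from the assumptions (3.35), (3.37)"* (the plaquette
variables of a background in the class are small);  p. 392 ∕ (3.69): Δ(U) = D\*_U D_U + (curvature terms small with the plaquette variables).

WHY THIS FILE.  The N06 certificate's row 17 takes Theorem 3.11 from the positivity pin `hPD` and ONE displayed clause `hΔA` = «Δ_a(U) is positive
definite on (3.35)» (`B9Thm311PosAtRecordV4.t311_of_pins_opsYOfLettersV4₁`; class-parametric twin `B9Thm39Thm311AtLettersR.t311_of_pins_opsYOfLettersV4₁R`)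
— a printed CONCLUSION of Theorem 3.11 displayed as its input, on purpose, to locate what is owed.  This seat's files `B9Ineq369CurvatureSmallAtLettersY`
∕ `B9Thm311PosOfPrincipalAtLettersY` (⟨A, Δ(U)A⟩ ≧ (1−δ)‖D_U A‖² − 12(d+1)c_f²δ‖A‖² when every plaquette satisfies |U(∂p) − 1| ≦ δ) and
`B9Eq335PlaquetteAtLettersY` ∕ `B9Eq335CoveragePAtLettersY` (on PRINT's class (3.35) every plaquette IS δ(K)-small, K = 10·L·M·α₀, δ(K) = 2K(1+K)e^{4K})
reduce that clause to the PRINCIPAL COERCIVITY of (3.26)'s gauge-fixed form.  THIS FILE states the reduction in the certificate's currency, ONCE at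
generic `(R₁, R₂)` and read at print's class:
* ★★ `t311_of_pins_principalR` — row 17 = `B9.Thm311Printed c35Y geo9Y (bg9YR … R₁ R₂) (fun x => (ops x).PosDef)` at `ops := opsYOfLetters N θ M⋆
  (lettersYOfRecordV4 …) 𝔈` from: the pin `hPD` (verbatim), the class axiom `hG : MemOfFam SU(N) R₁`, a uniform plaquette bound `δ ∈ [0, 1]` DISPLAYED on
  the class (`hplaq : … R₁-member ⇒ |U(∂p) − 1| ≦ δ`), the UNWEIGHTED principal coercivity DISPLAYED with a per-member constant `γ x`
  (`hcoer : … ⇒ γ x·⟨A,A⟩₁ ≦ ⟨D_U A, D_U A⟩₁ + ⟨D*_U A, R(U)D*_U A⟩₁ + ⟨Q(U)A, Q(U)A⟩_w`), and the explicit smallness inequality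
  `hγ : 12(d+1)·c_f(x)²·δ < (1 − δ)·γ x` («α₀ sufficiently small», located);
* `coer_weighted_of_unweighted` — the arithmetic step `(1−δ)γ⟨A,A⟩ ≦ (1−δ)‖D_UA‖² + ⟨D*A, RD*A⟩ + ‖QA‖²_w` (R(U) ≧ 0 as a symmetric idempotent,
  `B9Thm311ProjectionR.trIP_RY_parSymY_self_nonneg`; the averaging square ≧ 0);
* `plaq_le_of_regYP335` — on PRINT's class, under the certificate's provisos `0 < α₀`, `M·α₀ ≦ a₁`: every plaquette of an `R₁ = regYP335`-member
  satisfies |U(∂p) − 1| ≦ δ(10·L·a₁) (`norm_holY_sub_one_le_of_reg335P` + `plaqBound_mono`);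
* ★★★ `t311_of_pins_principal_P` — ROW 17 OVER PRINT's CLASS `bg9YP` FROM THE PIN AND THE PRINCIPAL COERCIVITY ALONE: displayed are `hcoer` (Theorem 3.3 ∕
  [4] content — the uniform lower bound of the principal gauge-fixed form on the class) and the real-number conditions `δ(10·L·a₁) ≦ 1`,
  `12(d+1)·c_f(x)²·δ(10·L·a₁) < (1 − δ(10·L·a₁))·γ x` on the threshold `a₁` of the proviso `M·α₀ ≦ a₁` — print's «α₀ sufficiently small».
CONSUMER: dag-n06-d's certificate (edition 8 at `carriersYR`, read at print's class): `hΔA` may be REPLACED by `hcoer` + the two inequalities (this face), or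
kept (the twin face) — the knit's call; zero ask.
HONEST SCOPE.  Composition of landed theorems + one line of real arithmetic; the principal coercivity (Thm 3.3 ∕ [4] (2.60)-type bound, uniform on the
class) stays a DISPLAYED hypothesis of printed shape; nothing of [B9] or [4] is asserted; NOT a node discharge, NOT summit progress; count-neutral; one
finite 𝕋⁴ programme — nothing continuum, nothing about the mass gap.  Cell `pub-ymgap` (HUMAN RULING D-0062), Track A node N06 [B9], seat
`pub-ymgap-dag-n06-j` (harness re-seat gen 12), 2026-08-27.  No `sorry`, no `axiom`, no `instance`, no `notation`, no `def`.
-/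

namespace Literature.MathematicalPhysics.QuantumFieldTheory.Balaban1983to89.B9Thm311PrincipalAtLettersR

open Literature.MathematicalPhysics.QuantumFieldTheory.Balaban1983to89
open B9Thm311Whole B9Thm311ReadingCoords B9Thm311ReadingAtLetters B9Thm311SymmAtRecordV4 B9Thm311PosAtRecordV4 B9Thm311ProjectionR
  B9Thm311DeltaPrimePos B9Thm311PosOfPrincipalAtLettersY B9Eq335CoveragePAtLettersY B9Thm39Thm311AtLettersR Node00
open B6KLevelCensusIndexV1 B9PinMembersKLevelV1 B9PinCarriersKLevelV1 B9PinGeometryKLevelV1 B7Prop2SpecialUnitary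
open B9BackgroundsKLevelV1R B9BackgroundsKLevelV1P
open scoped Matrix

noncomputable section

/-! ## §1 The arithmetic step: the weighted coercivity from the unweighted one -/

section Arithmetic

open scoped Matrix.Norms.L2Operator

variable {d ℓ : ℕ} {hd : 1 ≤ d + 1} {hL : Odd (ℓ + 1) ∧ 1 < ℓ + 1} {b₀ b₁ : ℝ} {N : ℕ}
variable (i : KIdx d ℓ hd hL b₀ b₁) {G : Subgroup (Matrix (Fin N) (Fin N) ℂ)ˣ}

/-- **THE WEIGHTED COERCIVITY FROM THE UNWEIGHTED ONE**: for a `G`-valued background (`G ≤ U(N)`), `0 ≤ δ ≤ 1` and the principal coercivity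
`γ⟨A,A⟩₁ ≦ ⟨D_U A, D_U A⟩₁ + ⟨D*_U A, R(U) D*_U A⟩₁ + ⟨Q(U)A, Q(U)A⟩_w`, also `(1−δ)γ⟨A,A⟩₁ ≦ (1−δ)⟨D_U A, D_U A⟩₁ + ⟨D*_U A, R(U) D*_U A⟩₁ + ⟨Q(U)A, Q(U)A⟩_w`
— the gauge-fixing square is ≧ 0 (R(U) symmetric idempotent, (3.25)) and so is the averaging square.
[cite: Balaban1985BackgroundPropagators, (3.25)–(3.26) p.395, bookkeeping] -/
theorem coer_weighted_of_unweighted (hG : G ≤ B7Prop2Explicit.unitaryUnits (Matrix (Fin N) (Fin N) ℂ))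
    {U : CfgY (Matrix (Fin N) (Fin N) ℂ) i} (hU : ∀ μ x, U μ x ∈ G) {δ γ : ℝ} (hδ0 : 0 ≤ δ) (hδ1 : δ ≤ 1)
    (hcoer : ∀ A : FBondY i → Matrix (Fin N) (Fin N) ℂ,
      γ * trIP (fun _ => (1 : ℝ)) A A ≤ trIP (fun _ => (1 : ℝ)) (curlY i U A) (curlY i U A)
        + trIP (fun _ => (1 : ℝ)) (divY i U A) (RY i (parSymY i) (GpY i (parSymY i)) U (divY i U A))
        + trIP i.w (QY i (parBY i) U A) (QY i (parBY i) U A))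
    (A : FBondY i → Matrix (Fin N) (Fin N) ℂ) :
    (1 - δ) * γ * trIP (fun _ => (1 : ℝ)) A A ≤ (1 - δ) * trIP (fun _ => (1 : ℝ)) (curlY i U A) (curlY i U A)
        + trIP (fun _ => (1 : ℝ)) (divY i U A) (RY i (parSymY i) (GpY i (parSymY i)) U (divY i U A))
        + trIP i.w (QY i (parBY i) U A) (QY i (parBY i) U A) := by
  have hr : 0 ≤ trIP (fun _ => (1 : ℝ)) (divY i U A) (RY i (parSymY i) (GpY i (parSymY i)) U (divY i U A)) :=
    trIP_RY_parSymY_self_nonneg i hG hU _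
  have hq : 0 ≤ trIP i.w (QY i (parBY i) U A) (QY i (parBY i) U A) := trIP_self_nonneg _ i.hw _
  have h := hcoer A
  have h1δ : 0 ≤ 1 - δ := by linarith
  nlinarith [mul_le_mul_of_nonneg_left h h1δ]

end Arithmetic

/-! ## §2 Row 17 at generic `(R₁, R₂)` from the pin, a displayed plaquette bound and the principal coercivity -/

section Generic

open scoped Matrix.Norms.L2Operator

variable {N : ℕ} (θ : Stage3Params) (Mstar : ℕ) (𝔯 : ResY N θ Mstar) (𝔈 : ExpsY N θ Mstar)
variable (R₁ R₂ : RegFamY θ.d₆ θ.ℓ₆ θ.hd' θ.hL' θ.b₀ θ.b₁ Mstar (Matrix (Fin N) (Fin N) ℂ))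

/-- ★★ **ROW 17 AT GENERIC `(R₁, R₂)` FROM THE PIN AND THE PRINCIPAL COERCIVITY**: from the positivity pin `hPD` (verbatim), the class axiom `hG` («U is
SU(N)-valued»), a uniform plaquette bound `δ ∈ [0,1]` on the class DISPLAYED on `R₁` (`hplaq`), the UNWEIGHTED principal coercivity of (3.26)'s gauge-fixed
form with a per-member constant `γ x` (`hcoer`) and the located smallness inequality `12(d+1)·c_f(x)²·δ < (1−δ)·γ x` (`hγ`):
`B9.Thm311Printed c35Y geo9Y (bg9YR … R₁ R₂) (fun x => ((opsYOfLetters N θ M⋆ (lettersYOfRecordV4 …) 𝔈) x).PosDef)` — by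
`t311_of_pins_opsYOfLettersV4₁R` with its clause `hΔA` DERIVED: ⟨A, Δ_a(U)A⟩ = ⟨A, Δ(U)A⟩ + ⟨D*A, RD*A⟩ + ‖QA‖²_w (`trIP_deltaAY_parSymY_eq`),
⟨A, Δ(U)A⟩ ≧ (1−δ)‖D_UA‖² − 12(d+1)c_f²δ‖A‖² (`trIP_hessY_ge_of_plaquette_small`), the weighted coercivity (§1), hence ⟨A, Δ_a A⟩ ≧ ((1−δ)γ − 12(d+1)c_f²δ)‖A‖² > 0
(`posDefTr_deltaAY_parSymY_of_principal`). [cite: Balaban1985BackgroundPropagators, Thm 3.11 p.416 + (3.26) p.395 + (3.69) p.404 + (3.35) p.396] -/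
theorem t311_of_pins_principalR (hG : MemOfFam (specialUnitaryUnits (Fin N)) R₁) (a₁ M₁ : ℝ) (ha₁ : 0 < a₁) (hM₁ : 0 < M₁)
    {δ : ℝ} (hδ0 : 0 ≤ δ) (hδ1 : δ ≤ 1) (γ : MemberY θ.d₆ θ.ℓ₆ θ.hd' θ.hL' θ.b₀ θ.b₁ Mstar → ℝ)
    (hplaq : ∀ x : MemberY θ.d₆ θ.ℓ₆ θ.hd' θ.hL' θ.b₀ θ.b₁ Mstar, M₁ ≤ (geo9Y x).M → ∀ α₀ : ℝ, 0 < α₀ → (geo9Y x).M * α₀ ≤ a₁ →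
      ∀ U : (bg9YR (Matrix (Fin N) (Fin N) ℂ) (specialUnitaryUnits (Fin N)) R₁ R₂ x).Cfg,
        (bg9YR (Matrix (Fin N) (Fin N) ℂ) (specialUnitaryUnits (Fin N)) R₁ R₂ x).Reg335 c35Y α₀ U →
          ∀ p : PlaqY x.toKIdx, ‖((holY x.toKIdx U p : (Matrix (Fin N) (Fin N) ℂ)ˣ) : Matrix (Fin N) (Fin N) ℂ) - 1‖ ≤ δ)
    (hcoer : ∀ x : MemberY θ.d₆ θ.ℓ₆ θ.hd' θ.hL' θ.b₀ θ.b₁ Mstar, M₁ ≤ (geo9Y x).M → ∀ α₀ : ℝ, 0 < α₀ → (geo9Y x).M * α₀ ≤ a₁ →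
      ∀ U : (bg9YR (Matrix (Fin N) (Fin N) ℂ) (specialUnitaryUnits (Fin N)) R₁ R₂ x).Cfg,
        (bg9YR (Matrix (Fin N) (Fin N) ℂ) (specialUnitaryUnits (Fin N)) R₁ R₂ x).Reg335 c35Y α₀ U →
          ∀ A : FBondY x.toKIdx → Matrix (Fin N) (Fin N) ℂ,
            γ x * trIP (fun _ => (1 : ℝ)) A A ≤ trIP (fun _ => (1 : ℝ)) (curlY x.toKIdx U A) (curlY x.toKIdx U A)
              + trIP (fun _ => (1 : ℝ)) (divY x.toKIdx U A)
                  (RY x.toKIdx (parSymY x.toKIdx) (GpY x.toKIdx (parSymY x.toKIdx)) U (divY x.toKIdx U A))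
              + trIP x.w (QY x.toKIdx (parBY x.toKIdx) U A) (QY x.toKIdx (parBY x.toKIdx) U A))
    (hγ : ∀ x : MemberY θ.d₆ θ.ℓ₆ θ.hd' θ.hL' θ.b₀ θ.b₁ Mstar, 12 * (θ.d₆ + 1) * x.cf ^ 2 * δ < (1 - δ) * γ x)
    (hPD : ∀ x : MemberY θ.d₆ θ.ℓ₆ θ.hd' θ.hL' θ.b₀ θ.b₁ Mstar,
      ((opsYOfLetters N θ Mstar (lettersYOfRecordV4 N θ Mstar 𝔯) 𝔈) x).PosDef
        = PosDefOfOps (ops311Y x (lettersYOfRecordV4 N θ Mstar 𝔯 x) (proofLettersOneV4 θ Mstar 𝔯 x))) :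
    B9.Thm311Printed c35Y geo9Y (bg9YR (Matrix (Fin N) (Fin N) ℂ) (specialUnitaryUnits (Fin N)) R₁ R₂)
      (fun x => ((opsYOfLetters N θ Mstar (lettersYOfRecordV4 N θ Mstar 𝔯) 𝔈) x).PosDef) :=
  t311_of_pins_opsYOfLettersV4₁R θ Mstar 𝔯 𝔈 R₁ R₂ hG a₁ M₁ ha₁ hM₁
    (fun x hM α₀ hα₀ hMa U hU =>
      posDefTr_deltaAY_parSymY_of_principal x.toKIdx specialUnitaryUnits_le_unitaryUnits (mem_of_reg335R hG x hU) hδ0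
        (hplaq x hM α₀ hα₀ hMa U hU)
        (coer_weighted_of_unweighted x.toKIdx specialUnitaryUnits_le_unitaryUnits (mem_of_reg335R hG x hU) hδ0 hδ1
          (hcoer x hM α₀ hα₀ hMa U hU))
        (hγ x))
    hPD

end Generic

/-! ## §3 At PRINT's class: the plaquette bound from (3.35) under the provisos, and row 17 from the coercivity alone -/

section Print

open scoped Matrix.Norms.L2Operator

variable {d ℓ : ℕ} {hd : 1 ≤ d + 1} {hL : Odd (ℓ + 1) ∧ 1 < ℓ + 1} {b₀ b₁ : ℝ} {Mstar N : ℕ}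

/-- **ON PRINT's CLASS EVERY PLAQUETTE OF A MEMBER IS δ(10·L·a₁)-SMALL UNDER THE PROVISOS** `0 ≤ α₀`, `M·α₀ ≦ a₁` (`N ≥ 1`): with δ(K) := 2K(1+K)e^{4K},
|U(∂p) − 1| ≦ δ(10·L·a₁) for every plaquette `p` of a background in `(bg9YP (M_N(ℂ)) SU(N) x).Reg335 c35Y α₀` — `norm_holY_sub_one_le_of_reg335P` at the member's
own index (bound δ(10·L·M·α₀)) and the monotonicity `plaqBound_mono` (`M·α₀ ≦ a₁`). [cite: Balaban1985BackgroundPropagators, (3.35) p.396 + (3.69) p.404] -/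
theorem plaq_le_of_regYP335 [Nonempty (Fin N)] (x : MemberY d ℓ hd hL b₀ b₁ Mstar) {α₀ a₁ : ℝ} (hα₀ : 0 ≤ α₀) (hMa : (geo9Y x).M * α₀ ≤ a₁)
    {U : (bg9YP (Matrix (Fin N) (Fin N) ℂ) (specialUnitaryUnits (Fin N)) x).Cfg}
    (h : (bg9YP (Matrix (Fin N) (Fin N) ℂ) (specialUnitaryUnits (Fin N)) x).Reg335 c35Y α₀ U) (p : PlaqY x.toKIdx) :
    ‖((holY x.toKIdx U p : (Matrix (Fin N) (Fin N) ℂ)ˣ) : Matrix (Fin N) (Fin N) ℂ) - 1‖ ≤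
      2 * (10 * ((ℓ + 1 : ℕ) : ℝ) * a₁) * (1 + 10 * ((ℓ + 1 : ℕ) : ℝ) * a₁) * Real.exp (4 * (10 * ((ℓ + 1 : ℕ) : ℝ) * a₁)) := by
  have hM : 0 ≤ (kGeo x.toKIdx).M := by
    show 0 ≤ ((ℓ + 1 : ℕ) : ℝ) * (x.toKIdx.Mh : ℝ)
    positivity
  have hMα : 0 ≤ (kGeo x.toKIdx).M * α₀ := mul_nonneg hM hα₀
  have hc : c35Y ≤ 10 := by norm_num [c35Y]
  have key := norm_holY_sub_one_le_of_reg335P x.toKIdx U hc hMα h.1 p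
  have hL0 : 0 ≤ 10 * (kGeo x.toKIdx).L := by
    show 0 ≤ 10 * (((ℓ + 1 : ℕ) : ℝ))
    positivity
  have hMa' : (kGeo x.toKIdx).M * α₀ ≤ a₁ := hMa
  have hC : 0 ≤ 10 * (kGeo x.toKIdx).L * ((kGeo x.toKIdx).M * α₀) := mul_nonneg hL0 hMα
  have hCC : 10 * (kGeo x.toKIdx).L * ((kGeo x.toKIdx).M * α₀) ≤ 10 * (kGeo x.toKIdx).L * a₁ := mul_le_mul_of_nonneg_left hMa' hL0
  exact key.trans (plaqBound_mono hC hCC)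

variable (θ : Stage3Params) (Mstar : ℕ) (𝔯 : ResY N θ Mstar) (𝔈 : ExpsY N θ Mstar)

/-- ★★★ **ROW 17 OVER PRINT's CLASS FROM THE PIN AND THE PRINCIPAL COERCIVITY ALONE**: with δ₁ := δ(10·L·a₁) = 2K(1+K)e^{4K}, K = 10·L·a₁ (L = θ.ℓ₆ + 1),
from the positivity pin `hPD` (verbatim), the UNWEIGHTED principal coercivity of the gauge-fixed form (3.26) on print's class (3.35) with per-member constant
`γ x` (`hcoer` — Theorem 3.3 ∕ [4] content, DISPLAYED) and the two real-number conditions on the proviso threshold `a₁` — `δ₁ ≦ 1` and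
`12(d+1)·c_f(x)²·δ₁ < (1 − δ₁)·γ x` (print's «α₀ sufficiently small», located) — Theorem 3.11 as typed over print's class:
`B9.Thm311Printed c35Y geo9Y (bg9YP …) (fun x => ((opsYOfLetters N θ M⋆ (lettersYOfRecordV4 …) 𝔈) x).PosDef)`.  The plaquette smallness is PROVED from (3.35)
(`plaq_le_of_regYP335`: coverage by print's cube class + the per-cube datum), «U is SU(N)-valued» is `memOfFam_regYP335`; §2 at `(regYP335, regYP336)`.
[cite: Balaban1985BackgroundPropagators, Thm 3.11 p.416 + (3.26) p.395 + (3.35) p.396 + (3.69) p.404] -/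
theorem t311_of_pins_principal_P [Nonempty (Fin N)] (a₁ M₁ : ℝ) (ha₁ : 0 < a₁) (hM₁ : 0 < M₁)
    (γ : MemberY θ.d₆ θ.ℓ₆ θ.hd' θ.hL' θ.b₀ θ.b₁ Mstar → ℝ)
    (hcoer : ∀ x : MemberY θ.d₆ θ.ℓ₆ θ.hd' θ.hL' θ.b₀ θ.b₁ Mstar, M₁ ≤ (geo9Y x).M → ∀ α₀ : ℝ, 0 < α₀ → (geo9Y x).M * α₀ ≤ a₁ →
      ∀ U : (bg9YP (Matrix (Fin N) (Fin N) ℂ) (specialUnitaryUnits (Fin N)) x).Cfg,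
        (bg9YP (Matrix (Fin N) (Fin N) ℂ) (specialUnitaryUnits (Fin N)) x).Reg335 c35Y α₀ U →
          ∀ A : FBondY x.toKIdx → Matrix (Fin N) (Fin N) ℂ,
            γ x * trIP (fun _ => (1 : ℝ)) A A ≤ trIP (fun _ => (1 : ℝ)) (curlY x.toKIdx U A) (curlY x.toKIdx U A)
              + trIP (fun _ => (1 : ℝ)) (divY x.toKIdx U A)
                  (RY x.toKIdx (parSymY x.toKIdx) (GpY x.toKIdx (parSymY x.toKIdx)) U (divY x.toKIdx U A))
              + trIP x.w (QY x.toKIdx (parBY x.toKIdx) U A) (QY x.toKIdx (parBY x.toKIdx) U A))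
    (hδ1 : 2 * (10 * ((θ.ℓ₆ + 1 : ℕ) : ℝ) * a₁) * (1 + 10 * ((θ.ℓ₆ + 1 : ℕ) : ℝ) * a₁) * Real.exp (4 * (10 * ((θ.ℓ₆ + 1 : ℕ) : ℝ) * a₁)) ≤ 1)
    (hγ : ∀ x : MemberY θ.d₆ θ.ℓ₆ θ.hd' θ.hL' θ.b₀ θ.b₁ Mstar,
      12 * (θ.d₆ + 1) * x.cf ^ 2 *
          (2 * (10 * ((θ.ℓ₆ + 1 : ℕ) : ℝ) * a₁) * (1 + 10 * ((θ.ℓ₆ + 1 : ℕ) : ℝ) * a₁) * Real.exp (4 * (10 * ((θ.ℓ₆ + 1 : ℕ) : ℝ) * a₁))) <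
        (1 - 2 * (10 * ((θ.ℓ₆ + 1 : ℕ) : ℝ) * a₁) * (1 + 10 * ((θ.ℓ₆ + 1 : ℕ) : ℝ) * a₁) * Real.exp (4 * (10 * ((θ.ℓ₆ + 1 : ℕ) : ℝ) * a₁))) * γ x)
    (hPD : ∀ x : MemberY θ.d₆ θ.ℓ₆ θ.hd' θ.hL' θ.b₀ θ.b₁ Mstar,
      ((opsYOfLetters N θ Mstar (lettersYOfRecordV4 N θ Mstar 𝔯) 𝔈) x).PosDef
        = PosDefOfOps (ops311Y x (lettersYOfRecordV4 N θ Mstar 𝔯 x) (proofLettersOneV4 θ Mstar 𝔯 x))) :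
    B9.Thm311Printed c35Y geo9Y (bg9YP (Matrix (Fin N) (Fin N) ℂ) (specialUnitaryUnits (Fin N)))
      (fun x => ((opsYOfLetters N θ Mstar (lettersYOfRecordV4 N θ Mstar 𝔯) 𝔈) x).PosDef) := by
  have hδ0 : 0 ≤ 2 * (10 * ((θ.ℓ₆ + 1 : ℕ) : ℝ) * a₁) * (1 + 10 * ((θ.ℓ₆ + 1 : ℕ) : ℝ) * a₁) *
      Real.exp (4 * (10 * ((θ.ℓ₆ + 1 : ℕ) : ℝ) * a₁)) := by
    have := Real.exp_pos (4 * (10 * ((θ.ℓ₆ + 1 : ℕ) : ℝ) * a₁))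
    have ha := ha₁.le
    positivity
  exact t311_of_pins_principalR θ Mstar 𝔯 𝔈
    (regYP335 (Matrix (Fin N) (Fin N) ℂ) (specialUnitaryUnits (Fin N))) (regYP336 (Matrix (Fin N) (Fin N) ℂ) (specialUnitaryUnits (Fin N)))
    memOfFam_regYP335 a₁ M₁ ha₁ hM₁ hδ0 hδ1 γ
    (fun x _ α₀ hα₀ hMa U hU p => plaq_le_of_regYP335 x hα₀.le hMa hU p) hcoer hγ hPD

end Print

end

end Literature.MathematicalPhysics.QuantumFieldTheory.Balaban1983to89.B9Thm311PrincipalAtLettersR
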